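import Literature.MathematicalPhysics.QuantumFieldTheory.Balaban1983to89.T3UnitScaleTilt
import Literature.MathematicalPhysics.QuantumFieldTheory.Balaban1983to89.T4PairDerivBridge
import Literature.Probability.Moments.HoeffdingEntropyBound
import HarnessLib

/-!
# `MultiscaleHerbstRegimeStubsProbe` — structure probe of field flip #6's two REGIME stubs of crux `HistoryTailL` (stmt-QuantumFields-19936),
# line `Cruxes/HistoryTailL/Lines/multiscale_herbst.lean` (route `MultiscaleHerbst`, DRAFT): **the ENTROPY clause is free per level, the
# CENTRING clause's window freedom is exactly computable** — cell `ym3-torus`, width seat `ym-ust-19936-w5` (g8)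

The regime stubs `stub_deepWindowHerbst` (`2j+2 ≤ K`) and `stub_shallowWindowHerbst` (`K < 2j+2`) both assert, for one `σ > 0` chosen BEFORE
`(K, j, a)`, a measurable window `W ⊇ G` (`G` = good history below `j` ∩ conditioner at `j+2`) carrying two clauses for the normalised deviation
`f = dist1(Ū^j(∂a))/g`, `g = √(γL^{−(K−j)})`, under `μ = gibbsK F ℰp γ K`:
(centring) `∫_W f dμ ≤ (p(g)/4)·μ(W)` and (entropy) `∀ t ≥ 0, ∫_W e^{tf}·tf dμ − (∫_W e^{tf} dμ)·log((∫_W e^{tf} dμ)/μ(W)) ≤ (σ²t²/2)·∫_W e^{tf} dμ`.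

WHAT THIS FILE PROVES (def-free, kernel facts; nothing of the stubs' CONTENT is claimed):
* §1 the observable `f` is measurable with `0 ≤ f ≤ 2/g` (`dist1 ≤ 2` on `SU(2)`);
* §2 ★ `entropyClause_perLevel` — for EVERY family, coupling `γ > 0`, cut-off `K`, height `j`, plaquette `a`, EVERY measurable `W` and EVERY real `t`,
  the entropy clause holds VERBATIM with `σ := (√(γL^{−(K−j)}))⁻¹ = 1/g` — Hoeffding's lemma in entropy form
  (`Literature.Probability.Moments.setIntegral_entropy_exp_mul_le_of_mem_Icc`, Giné–Nickl (3.119)) for the `[0, 2/g]`-valued `f`;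
  hence ★ `entropyConjunct_sigma_after_level` — the stubs' fourth conjunct with the quantifier `∃ σ` moved AFTER `(K, j, a, W)` is a theorem:
  the clause carries no content except the ORDER «one σ for all levels» (K-uniformity = the route's two-scale LSI), and no choice of `W` can
  manufacture it from boundedness;
* §3 ★ `exists_window_setIntegral_le_iff` — for a finite measure, measurable `G`, integrable `f` and a constant `c`:
  `(∃ W ⊇ G measurable, ∫_W f ≤ c·μ(W)) ↔ ∫_{G ∩ {c ≤ f}} (f − c) ≤ ∫_{{f < c}} (c − f)`, with optimal window `W* = G ∪ {f < c}`:
  the centring clause ALONE asks only that the excess of `f` over `p/4` on the good history be paid by the global deficit below `p/4`;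
  the stub, however, needs ONE `W` for both clauses, and on a window `W ≈ G` the centring clause is the conditional first moment
  `E[dist1(Ū^j(∂a)); G] ≤ g·p(g)/4·μ(G)` one averaging step above a `θ(K−j+1)`-small history (CLT-scale; deterministic one-step transport misses
  it by the factor `4·T₁·L^{−1/2}`, `T₁ ≥ L²` the sup-transport constant).
LOCATED CONTENT OF THE TWO REGIME STUBS, BY CLAUSE: entropy ⇒ K-UNIFORM `σ` on a window (log-Sobolev input, XL); centring on a window ⇒ CLT-scale
conditional mean ((α)-type, first-moment version).  Everything else in the stubs is bookkeeping proved here.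

HONEST FRAMING.  YM₃ on T³ is rung R3 of the programme (finite-torus SU(2)), NOT d = 4, NOT the continuum in infinite volume, NOT a mass gap, NOT the
Clay problem.  Nothing here proves `stub_deepWindowHerbst`, `stub_shallowWindowHerbst`, `WindowHerbstL`, `TwoSidedOfWindowHerbst` (item 28166,
★w2-19936 g8's pen), `TowerTailL` or `HistoryTailL`; count-neutral helper (`--supports stmt-QuantumFields-19936`); imports Literature only (no Theses cone).

References: E. Giné, R. Nickl, *Mathematical Foundations of Infinite-Dimensional Statistical Models*, CUP 2016, Lemma 3.1.1, (3.118)–(3.119)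
[GineNickl2021]; T. Bałaban, Commun. Math. Phys. 102 (1985) 255–275 [Balaban1985UV3] ((7) p.257: the thresholds `g_k p(g_k)`).
-/

set_option autoImplicit false

noncomputable section

namespace Summit.QuantumFields.YangMills.Theorems.MultiscaleHerbstRegimeStubsProbe

open MeasureTheory Real Set
open Literature.MathematicalPhysics.QuantumFieldTheory.Balaban1983to89
open Literature.MathematicalPhysics.QuantumFieldTheory.Balaban1983to89.T3ContinuumYM3Torus
open Literature.MathematicalPhysics.QuantumFieldTheory.Balaban1983to89.T3UnitScaleTilt
open Literature.MathematicalPhysics.QuantumFieldTheory.Balaban1983to89.T3UnitLawDensityEML (ℰp measurableE_ℰp)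
open Literature.MathematicalPhysics.QuantumFieldTheory.Balaban1983to89.Missing
open Literature.MathematicalPhysics.QuantumFieldTheory.Balaban1983to89.T4Continuum
open Literature.MathematicalPhysics.QuantumFieldTheory.Balaban1983to89.T4PairDerivBridge (dist1_le_two_specialUnitaryGroup)
open Literature.Probability.Moments (setIntegral_entropy_exp_mul_le_of_mem_Icc)

/-! ## §1 The observable `f = dist1(Ū^j(∂a))/g`: measurable, with values in `[0, 2/g]` -/

section Observable

variable (F : T3Family)

/-- `U ↦ dist1(Ū^j(∂a))` is measurable (measurable (0.4)-averaging maps for the measurable `ℰp`, measurable plaquette variable, measurable `dist1`).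
[cite: Balaban1987RG1, (0.4) p.253] -/
theorem measurable_dist1_plaqHol_iter (K j : ℕ) (a : Plaq (F.P K) j) :
    Measurable fun U : GaugeField (F.P K) 0 (Matrix.specialUnitaryGroup (Fin 2) ℂ) =>
      GaugeGroup.dist1 (GaugeField.plaqHol (Averaging.iter (fun i' => BlockAveraging.blockAvg (P := F.P K) (j := i') ℰp) j U) a) :=
  RegularGaugeGroup.measurable_dist1.comp ((Missing.measurable_plaqHol a).comp
    (measurable_iter _ (F.avgMeasurable_of_measurableE ℰp measurableE_ℰp K) j))

/-- The scale `g = √(γL^{−(K−j)})` is positive for `γ > 0`. [cite: Balaban1985UV3, (3) p.256] -/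
theorem sqrt_scale_pos {γ : ℝ} (hγ : 0 < γ) (K j : ℕ) : 0 < Real.sqrt (γ * ((F.L : ℝ)⁻¹) ^ (K - j)) := by
  have hL : (0 : ℝ) < F.L := by exact_mod_cast (zero_lt_one.trans F.hL.2)
  exact Real.sqrt_pos.2 (mul_pos hγ (pow_pos (inv_pos.2 hL) _))

/-- `0 ≤ dist1(Ū^j(∂a))/g ≤ 2/g` for `γ > 0` (`dist1 ≤ 2` on `SU(2)`). [folklore] -/
theorem dist1_div_mem_Icc {γ : ℝ} (hγ : 0 < γ) (K j : ℕ) (a : Plaq (F.P K) j)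
    (U : GaugeField (F.P K) 0 (Matrix.specialUnitaryGroup (Fin 2) ℂ)) :
    GaugeGroup.dist1 (GaugeField.plaqHol (Averaging.iter (fun i' => BlockAveraging.blockAvg (P := F.P K) (j := i') ℰp) j U) a) /
        Real.sqrt (γ * ((F.L : ℝ)⁻¹) ^ (K - j)) ∈
      Icc (0 : ℝ) (2 / Real.sqrt (γ * ((F.L : ℝ)⁻¹) ^ (K - j))) := by
  have hg := sqrt_scale_pos F hγ K j
  exact ⟨div_nonneg (GaugeGroup.dist1_nonneg _) hg.le,
    div_le_div_of_nonneg_right (dist1_le_two_specialUnitaryGroup _) hg.le⟩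

end Observable

/-! ## §2 The entropy clause of both regime stubs holds at EVERY level with `σ = 1/g` (Hoeffding's lemma in entropy form) -/

section Entropy

variable (F : T3Family)

/-- ★ **THE ENTROPY CLAUSE IS FREE PER LEVEL.**  For every family `F`, coupling `γ > 0`, cut-off `K`, height `j`, plaquette `a`, every measurable window
`W` and every real `t`, the entropy clause of `stub_deepWindowHerbst` / `stub_shallowWindowHerbst` holds VERBATIM with
`σ := (√(γL^{−(K−j)}))⁻¹ = 1/g_{K−j}`: since `f = dist1(Ū^j(∂a))/g ∈ [0, 2/g]` on all of the space, Hoeffding's lemma in entropy form gives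
`Ent_W(e^{tf}) ≤ ((2/g)²/8)·t²·∫_W e^{tf} = (σ²t²/2)·∫_W e^{tf}`. [cite: GineNickl2021, Thm 3.3.14 proof (3.118)-(3.119)] -/
theorem entropyClause_perLevel {γ : ℝ} (hγ : 0 < γ) (K j : ℕ) (a : Plaq (F.P K) j)
    {W : Set (GaugeField (F.P K) 0 (Matrix.specialUnitaryGroup (Fin 2) ℂ))} (hW : MeasurableSet W) (t : ℝ) :
    (∫ U in W, Real.exp (t * (GaugeGroup.dist1 (GaugeField.plaqHol (Averaging.iter (fun i' => BlockAveraging.blockAvg (P := F.P K) (j := i') T3UnitLawDensityEML.ℰp) j U) a) / Real.sqrt (γ * ((F.L : ℝ)⁻¹) ^ (K - j)))) * (t * (GaugeGroup.dist1 (GaugeField.plaqHol (Averaging.iter (fun i' => BlockAveraging.blockAvg (P := F.P K) (j := i') T3UnitLawDensityEML.ℰp) j U) a) / Real.sqrt (γ * ((F.L : ℝ)⁻¹) ^ (K - j)))) ∂(T3UnitScaleTilt.gibbsK F T3UnitLawDensityEML.ℰp γ K)) - (∫ U in W, Real.exp (t * (GaugeGroup.dist1 (GaugeField.plaqHol (Averaging.iter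 (fun i' => BlockAveraging.blockAvg (P := F.P K) (j := i') T3UnitLawDensityEML.ℰp) j U) a) / Real.sqrt (γ * ((F.L : ℝ)⁻¹) ^ (K - j)))) ∂(T3UnitScaleTilt.gibbsK F T3UnitLawDensityEML.ℰp γ K)) * Real.log ((∫ U in W, Real.exp (t * (GaugeGroup.dist1 (GaugeField.plaqHol (Averaging.iter (fun i' => BlockAveraging.blockAvg (P := F.P K) (j := i') T3UnitLawDensityEML.ℰp) j U) a) / Real.sqrt (γ * ((F.L : ℝ)⁻¹) ^ (K - j)))) ∂(T3UnitScaleTilt.gibbsK F T3UnitLawDensityEML.ℰp γ K)) / (T3UnitScaleTilt.gibbsK F T3UnitLawDensityEML.ℰp γ K).real W) ≤ (Real.sqrt (γ * ((F.L : ℝ)⁻¹) ^ (K - j)))⁻¹ ^ 2 * t ^ 2 / 2 * ∫ U in W, Real.exp (t * (GaugeGroup.dist1 (GaugeField.plaqHol (Averaging.iter (fun i' => BlockAveraging.blockAvg (P := F.P K) (j := i') T3UnitLawDensityEML.ℰp) j U) a) / Real.sqrt (γ * ((F.L : ℝ)⁻¹) ^ (K - j)))) ∂(T3UnitScaleTilt.gibbsK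 F T3UnitLawDensityEML.ℰp γ K) := by
  haveI := isProbabilityMeasure_gibbsK F ℰp hγ.le K
  set g : ℝ := Real.sqrt (γ * ((F.L : ℝ)⁻¹) ^ (K - j)) with hgdef
  have hg : 0 < g := sqrt_scale_pos F hγ K j
  have h := setIntegral_entropy_exp_mul_le_of_mem_Icc (gibbsK F ℰp γ K) hW
    ((measurable_dist1_plaqHol_iter F K j a).div_const g) (fun U _ => dist1_div_mem_Icc F hγ K j a U) t
  have hconst : (2 / g - 0) ^ 2 / 8 * t ^ 2 = g⁻¹ ^ 2 * t ^ 2 / 2 := by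
    field_simp
    ring
  rw [hconst] at h
  exact h

/-- ★ **THE STUBS' FOURTH CONJUNCT WITH `∃ σ` AFTER THE LEVEL.**  For every `F`, `γ > 0`, `K`, `j`, `a` and every measurable `W` there is `σ > 0`
(namely `1/g_{K−j}`) such that the entropy clause holds for all `t ≥ 0` — the regime stubs' entropy clause minus the quantifier order
«one σ before all (K, j)» is a theorem; its content is K-uniformity of σ alone. [cite: GineNickl2021, Thm 3.3.14 proof (3.118)-(3.119)] -/
theorem entropyConjunct_sigma_after_level {γ : ℝ} (hγ : 0 < γ) (K j : ℕ) (a : Plaq (F.P K) j)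
    {W : Set (GaugeField (F.P K) 0 (Matrix.specialUnitaryGroup (Fin 2) ℂ))} (hW : MeasurableSet W) :
    ∃ σ : ℝ, 0 < σ ∧ ∀ (t : ℝ), 0 ≤ t → (∫ U in W, Real.exp (t * (GaugeGroup.dist1 (GaugeField.plaqHol (Averaging.iter (fun i' => BlockAveraging.blockAvg (P := F.P K) (j := i') T3UnitLawDensityEML.ℰp) j U) a) / Real.sqrt (γ * ((F.L : ℝ)⁻¹) ^ (K - j)))) * (t * (GaugeGroup.dist1 (GaugeField.plaqHol (Averaging.iter (fun i' => BlockAveraging.blockAvg (P := F.P K) (j := i') T3UnitLawDensityEML.ℰp) j U) a) / Real.sqrt (γ * ((F.L : ℝ)⁻¹) ^ (K - j)))) ∂(T3UnitScaleTilt.gibbsK F T3UnitLawDensityEML.ℰp γ K)) - (∫ U in W, Real.exp (t * (GaugeGroup.dist1 (GaugeField.plaqHol (Averaging.iter (fun i' => BlockAveraging.blockAvg (P := F.P K) (j := i') T3UnitLawDensityEML.ℰp) j U) a) / Real.sqrt (γ * ((F.L : ℝ)⁻¹) ^ (K - j)))) ∂(T3UnitScaleTilt.gibbsK F T3UnitLawDensityEML.ℰp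 γ K)) * Real.log ((∫ U in W, Real.exp (t * (GaugeGroup.dist1 (GaugeField.plaqHol (Averaging.iter (fun i' => BlockAveraging.blockAvg (P := F.P K) (j := i') T3UnitLawDensityEML.ℰp) j U) a) / Real.sqrt (γ * ((F.L : ℝ)⁻¹) ^ (K - j)))) ∂(T3UnitScaleTilt.gibbsK F T3UnitLawDensityEML.ℰp γ K)) / (T3UnitScaleTilt.gibbsK F T3UnitLawDensityEML.ℰp γ K).real W) ≤ σ ^ 2 * t ^ 2 / 2 * ∫ U in W, Real.exp (t * (GaugeGroup.dist1 (GaugeField.plaqHol (Averaging.iter (fun i' => BlockAveraging.blockAvg (P := F.P K) (j := i') T3UnitLawDensityEML.ℰp) j U) a) / Real.sqrt (γ * ((F.L : ℝ)⁻¹) ^ (K - j)))) ∂(T3UnitScaleTilt.gibbsK F T3UnitLawDensityEML.ℰp γ K) :=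
  ⟨(Real.sqrt (γ * ((F.L : ℝ)⁻¹) ^ (K - j)))⁻¹, inv_pos.2 (sqrt_scale_pos F hγ K j),
    fun t _ => entropyClause_perLevel F hγ K j a hW t⟩

end Entropy

/-! ## §3 The centring clause: the freedom in the window `W ⊇ G` is exactly computable -/

section Centring

variable {Ω : Type*} [MeasurableSpace Ω] (μ : Measure Ω) [IsFiniteMeasure μ] {G : Set Ω} {f : Ω → ℝ}

/-- On a set of finite measure, `∫_W f ≤ c·μ(W)` iff `∫_W (f − c) ≤ 0`. [folklore] -/
theorem setIntegral_le_const_mul_iff (hfi : Integrable f μ) {W : Set Ω} (c : ℝ) :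
    ∫ x in W, f x ∂μ ≤ c * μ.real W ↔ ∫ x in W, (f x - c) ∂μ ≤ 0 := by
  rw [integral_sub hfi.integrableOn (integrableOn_const), setIntegral_const, smul_eq_mul, sub_nonpos, mul_comm]

/-- ★ **EXACT SATISFIABILITY OF THE CENTRING CLAUSE OVER WINDOWS `W ⊇ G`.**  For a finite measure `μ`, a measurable `G`, a measurable integrable `f`
and a constant `c`: there is a measurable `W ⊇ G` with `∫_W f dμ ≤ c·μ(W)` if and only if
`∫_{G ∩ {c ≤ f}} (f − c) dμ ≤ ∫_{{f < c}} (c − f) dμ`; the optimal window is `W* = G ∪ {f < c}` (enlarging `W` helps exactly where `f < c`).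
[folklore] -/
theorem exists_window_setIntegral_le_iff (hG : MeasurableSet G) (hf : Measurable f) (hfi : Integrable f μ) (c : ℝ) :
    (∃ W : Set Ω, MeasurableSet W ∧ G ⊆ W ∧ ∫ x in W, f x ∂μ ≤ c * μ.real W) ↔
      ∫ x in G ∩ {x | c ≤ f x}, (f x - c) ∂μ ≤ ∫ x in {x | f x < c}, (c - f x) ∂μ := by
  have hA : MeasurableSet {x | c ≤ f x} := measurableSet_le measurable_const hf
  have hB : MeasurableSet {x | f x < c} := measurableSet_lt hf measurable_const
  have hfc : Integrable (fun x => f x - c) μ := hfi.sub (integrable_const c)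
  have hcf : Integrable (fun x => c - f x) μ := (integrable_const c).sub hfi
  have hneg : ∀ S : Set Ω, ∫ x in S, (f x - c) ∂μ = -∫ x in S, (c - f x) ∂μ := fun S => by
    rw [← integral_neg]
    exact integral_congr_ae (ae_of_all _ fun x => by ring)
  constructor
  · rintro ⟨W, hWm, hGW, hle⟩
    rw [setIntegral_le_const_mul_iff μ hfi] at hle
    -- split `W` along `{c ≤ f}` / `{f < c}`
    have hWsplit : W ∩ {x | c ≤ f x} ∪ W ∩ {x | f x < c} = W := by
      ext x
      simp only [mem_inter_iff, mem_setOf_eq, mem_union]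
      constructor
      · rintro (⟨hx, -⟩ | ⟨hx, -⟩) <;> exact hx
      · intro hx
        rcases le_or_gt c (f x) with h | h
        · exact Or.inl ⟨hx, h⟩
        · exact Or.inr ⟨hx, h⟩
    have hdisjW : Disjoint (W ∩ {x | c ≤ f x}) (W ∩ {x | f x < c}) :=
      Set.disjoint_left.2 fun x hx hx' =>
        absurd (show f x < c from hx'.2) (not_lt.2 (show c ≤ f x from hx.2))
    have hsplit : ∫ x in W, (f x - c) ∂μ =
        ∫ x in W ∩ {x | c ≤ f x}, (f x - c) ∂μ + ∫ x in W ∩ {x | f x < c}, (f x - c) ∂μ := by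
      rw [← setIntegral_union hdisjW (hWm.inter hB) hfc.integrableOn hfc.integrableOn, hWsplit]
    -- the positive part dominates the `G`-part, the negative part is dominated by the global deficit
    have h1 : ∫ x in G ∩ {x | c ≤ f x}, (f x - c) ∂μ ≤ ∫ x in W ∩ {x | c ≤ f x}, (f x - c) ∂μ :=
      setIntegral_mono_set hfc.integrableOn
        (ae_restrict_of_forall_mem (hWm.inter hA) fun x hx => sub_nonneg.2 hx.2)
        (inter_subset_inter_left _ hGW).eventuallyLE
    have h2 : ∫ x in W ∩ {x | f x < c}, (c - f x) ∂μ ≤ ∫ x in {x | f x < c}, (c - f x) ∂μ :=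
      setIntegral_mono_set hcf.integrableOn
        (ae_restrict_of_forall_mem hB fun x hx => sub_nonneg.2 (le_of_lt hx))
        inter_subset_right.eventuallyLE
    rw [hsplit, hneg (W ∩ {x | f x < c})] at hle
    linarith
  · intro hle
    refine ⟨G ∪ {x | f x < c}, hG.union hB, subset_union_left, ?_⟩
    rw [setIntegral_le_const_mul_iff μ hfi]
    have hset : G ∪ {x | f x < c} = (G ∩ {x | c ≤ f x}) ∪ {x | f x < c} := by
      ext x
      simp only [mem_union, mem_inter_iff, mem_setOf_eq]
      constructor
      · rintro (hx | hx)
        · rcases le_or_gt c (f x) with h | h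
          · exact Or.inl ⟨hx, h⟩
          · exact Or.inr h
        · exact Or.inr hx
      · rintro (⟨hx, -⟩ | hx)
        · exact Or.inl hx
        · exact Or.inr hx
    have hdisj : Disjoint (G ∩ {x | c ≤ f x}) {x | f x < c} :=
      Set.disjoint_left.2 fun x hx hx' =>
        absurd (show f x < c from hx') (not_lt.2 (show c ≤ f x from hx.2))
    rw [hset, setIntegral_union hdisj hB hfc.integrableOn hfc.integrableOn, hneg {x | f x < c}]
    linarith

end Centring

end Summit.QuantumFields.YangMills.Theorems.MultiscaleHerbstRegimeStubsProbe

end
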